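import Mathlib.Analysis.Calculus.Deriv.Inv
import Mathlib.Analysis.Calculus.Gradient.Basic
import Mathlib.Analysis.SpecialFunctions.Sqrt
import Literature.Analysis.FluidPDE.MeridianReduction
import HarnessLib

/-!
# Gavrilov's axisymmetric ansatz (4) in Cartesian coordinates: the local steady Euler flow

Topic `Literature/Analysis/FluidPDE`; support file for the discharge of the named fact
`Literature.Analysis.FluidPDE.gavrilov_compact_steady_euler` (Gavrilov 2019, §1 Theorem):
the Lemma of §3 ("The fields `(u, p)` given by (4) satisfy (3) in a neighbourhood of `𝒞`").

Gavrilov (GAFA 29 (2019), §3) writes the steady Euler equations for an axisymmetric field in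
cylindrical coordinates (his (3)) and checks them for the ansatz (4),
`u = ρ⁻¹(∂_z p e_ρ − ∂_ρ p e_z + b e_φ)`, `p = aR⁴/4`, `b = R³√H(a)/4`, reducing the `e_ρ`- and
`e_z`-equations to two scalar identities for `α` (proved in `GavrilovLocalSolution.lean` as
`alpha_pde1`, `alpha_pde3`) and the `e_φ`-equation to `u·∇b = 0`.  The tree's Euler vocabulary is
Cartesian (`convect`, `gradient`, `VectorCalculus.divergence` on `EuclideanSpace ℝ (Fin 3)`), so
this file performs the verification directly in Cartesian coordinates, for abstract meridian
data `A : Gavrilov.AnsatzData` (functions `a, c` of `(ρ, z)` with their first/second partials,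
the two scalar identities, and `{c, a} = 0`), in the normalisation `(U, P) = (4u, 16p)`:
`U = ((a_z X₀ − c X₁)/ρ², (a_z X₁ + c X₀)/ρ², −a_ρ/ρ)`, `P = 4a`, where `a_ρ, a_z, c` are
evaluated at `(ρ, z) = (cylRadius X, X 2)`.

## Main statements (all proved)

* `AnsatzData.divergence_U` : `div U = 0` on the tube over the meridian domain;
* `AnsatzData.convect_U_add_gradient_P` : `(U·∇)U + ∇P = 0` there;
* `AnsatzData.fderiv_P_U` : `U·∇P = 0` (the pressure is a first integral, Gavrilov §3/§4);
* `AnsatzData.swirl_U` : the swirl of `U` is `c(ρ, z)`;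
* `AnsatzData.contDiffOn_U`, `AnsatzData.contDiffOn_P`, `AnsatzData.U_rotZ`, `AnsatzData.P_rotZ`.

## References

* A. V. Gavrilov, *A steady Euler flow with compact support*, Geom. Funct. Anal. 29 (2019)
  190–197, §3: the system (3), the ansatz (4) and the Lemma following it. [`Gavrilov2019`]
-/

noncomputable section

open Set Filter Function WithLp InnerProductSpace
open scoped Topology RealInnerProductSpace

namespace Literature.Analysis.FluidPDE

/-- Local notation for physical space `ℝ³ = EuclideanSpace ℝ (Fin 3)`. -/
local notation "ℝ³" => EuclideanSpace ℝ (Fin 3)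

namespace Gavrilov

/-! ### Meridian data of the ansatz -/

/-- The meridian data of Gavrilov's ansatz (4) (normalised, radius `1`): an open set `W` of the
half-plane `ρ > 0`, functions `a` (`= α`, the pressure up to the factor `4`) and `c` (`= √H(α)`,
the swirl) on it with their first and second partial derivatives, the two scalar identities to
which the `e_ρ`- and `e_z`-components of the Euler system (3) reduce (Gavrilov §3, proof of the
Lemma), and the Poisson-bracket condition `{c, a} = 0` expressing that `c` is a function of `a`
(the `e_φ`-component). [cite: Gavrilov2019, §3 (3), (4) and the Lemma] -/
structure AnsatzData where
  /-- the meridian domain -/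
  W : Set (ℝ × ℝ)
  isOpen_W : IsOpen W
  W_pos : ∀ q ∈ W, 0 < q.1
  /-- `a(ρ, z)` -/
  a : ℝ × ℝ → ℝ
  /-- `∂a/∂ρ` -/
  ax : ℝ × ℝ → ℝ
  /-- `∂a/∂z` -/
  ay : ℝ × ℝ → ℝ
  /-- `∂²a/∂ρ²` -/
  axx : ℝ × ℝ → ℝ
  /-- `∂²a/∂ρ∂z` -/
  axy : ℝ × ℝ → ℝ
  /-- `∂²a/∂z²` -/
  ayy : ℝ × ℝ → ℝ
  /-- the swirl profile `c(ρ, z)` -/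
  c : ℝ × ℝ → ℝ
  /-- `∂c/∂ρ` -/
  cx : ℝ × ℝ → ℝ
  /-- `∂c/∂z` -/
  cy : ℝ × ℝ → ℝ
  hasFDerivAt_a : ∀ q ∈ W, HasFDerivAt a
    (ax q • ContinuousLinearMap.fst ℝ ℝ ℝ + ay q • ContinuousLinearMap.snd ℝ ℝ ℝ) q
  hasFDerivAt_ax : ∀ q ∈ W, HasFDerivAt ax
    (axx q • ContinuousLinearMap.fst ℝ ℝ ℝ + axy q • ContinuousLinearMap.snd ℝ ℝ ℝ) q
  hasFDerivAt_ay : ∀ q ∈ W, HasFDerivAt ay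
    (axy q • ContinuousLinearMap.fst ℝ ℝ ℝ + ayy q • ContinuousLinearMap.snd ℝ ℝ ℝ) q
  hasFDerivAt_c : ∀ q ∈ W, HasFDerivAt c
    (cx q • ContinuousLinearMap.fst ℝ ℝ ℝ + cy q • ContinuousLinearMap.snd ℝ ℝ ℝ) q
  contDiffOn_a : ContDiffOn ℝ (⊤ : ℕ∞) a W
  contDiffOn_ax : ContDiffOn ℝ (⊤ : ℕ∞) ax W
  contDiffOn_ay : ContDiffOn ℝ (⊤ : ℕ∞) ay W
  contDiffOn_c : ContDiffOn ℝ (⊤ : ℕ∞) c W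
  bracket : ∀ q ∈ W, cx q * ay q = cy q * ax q
  pde1 : ∀ q ∈ W, q.1 * ax q * ayy q - q.1 * ay q * axy q + ay q ^ 2 - 4 * q.1 ^ 3 * ax q +
    c q ^ 2 = 0
  pde3 : ∀ q ∈ W, q.1 * ax q * axy q + ay q * (ax q + 4 * q.1 ^ 3 - q.1 * axx q) = 0

namespace AnsatzData

variable (A : AnsatzData)

/-- The solid of revolution `{X : (cylRadius X, X₂) ∈ W}` over the meridian domain. [folklore] -/
def tube : Set ℝ³ := meridian ⁻¹' A.W

/-- `a` lifted to `ℝ³`. [folklore] -/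
def la (X : ℝ³) : ℝ := A.a (meridian X)

/-- `∂a/∂ρ` lifted to `ℝ³`. [folklore] -/
def lax (X : ℝ³) : ℝ := A.ax (meridian X)

/-- `∂a/∂z` lifted to `ℝ³`. [folklore] -/
def lay (X : ℝ³) : ℝ := A.ay (meridian X)

/-- `c` lifted to `ℝ³`. [folklore] -/
def lc (X : ℝ³) : ℝ := A.c (meridian X)

/-- **Gavrilov's velocity field (4)** (times `4`, radius `1`) in Cartesian coordinates:
`U = ρ⁻¹(a_z e_ρ − a_ρ e_z + c e_φ) = ((a_z X₀ − c X₁)/ρ², (a_z X₁ + c X₀)/ρ², −a_ρ/ρ)`.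
[cite: Gavrilov2019, §3 (4)] -/
def U (X : ℝ³) : ℝ³ :=
  toLp 2 ![(A.lay X * X 0 - A.lc X * X 1) * (X 0 ^ 2 + X 1 ^ 2)⁻¹,
    (A.lay X * X 1 + A.lc X * X 0) * (X 0 ^ 2 + X 1 ^ 2)⁻¹,
    -(A.lax X * (cylRadius X)⁻¹)]

/-- **Gavrilov's pressure (4)** (times `16`, radius `1`): `P = 4a(ρ, z)`. [cite: Gavrilov2019, §3 (4)] -/
def P (X : ℝ³) : ℝ := 4 * A.la X

variable {A}

/-- Components of `U`. [folklore] -/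
@[simp] theorem U_apply_zero (X : ℝ³) :
    A.U X 0 = (A.lay X * X 0 - A.lc X * X 1) * (X 0 ^ 2 + X 1 ^ 2)⁻¹ := rfl

/-- Components of `U`. [folklore] -/
@[simp] theorem U_apply_one (X : ℝ³) :
    A.U X 1 = (A.lay X * X 1 + A.lc X * X 0) * (X 0 ^ 2 + X 1 ^ 2)⁻¹ := rfl

/-- Components of `U`. [folklore] -/
@[simp] theorem U_apply_two (X : ℝ³) : A.U X 2 = -(A.lax X * (cylRadius X)⁻¹) := rfl

/-- The tube is open. [folklore] -/
theorem isOpen_tube : IsOpen A.tube := by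
  have hc : Continuous meridian := continuous_cylRadius.prodMk (by fun_prop)
  exact A.isOpen_W.preimage hc

/-- Points of the tube are off the axis. [folklore] -/
theorem cylRadius_pos {X : ℝ³} (hX : X ∈ A.tube) : 0 < cylRadius X := A.W_pos _ hX

/-- Points of the tube are off the axis. [folklore] -/
theorem cylRadius_ne_zero {X : ℝ³} (hX : X ∈ A.tube) : cylRadius X ≠ 0 := (cylRadius_pos hX).ne'

/-- Points of the tube are off the axis: `X₀² + X₁² ≠ 0`. [folklore] -/
theorem sumSq_ne_zero {X : ℝ³} (hX : X ∈ A.tube) : X 0 ^ 2 + X 1 ^ 2 ≠ 0 := by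
  rw [← cylRadius_sq]
  exact pow_ne_zero 2 (cylRadius_ne_zero hX)

/-! ### Derivatives of the building blocks -/

/-- The coordinate functions are differentiable with derivative the projection. [folklore] -/
theorem hasFDerivAt_coord (i : Fin 3) (X : ℝ³) :
    HasFDerivAt (fun Y : ℝ³ => Y i) (EuclideanSpace.proj i : ℝ³ →L[ℝ] ℝ) X :=
  (EuclideanSpace.proj i : ℝ³ →L[ℝ] ℝ).hasFDerivAt

/-- **Chain rule for lifted meridian functions**: if `DG(ρ, z) = G_ρ dρ + G_z dz` then
`D(G ∘ meridian)(X) = G_ρ ⟪e_r(X), ·⟫ + G_z dX₂`. [folklore] -/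
theorem hasFDerivAt_lift {G : ℝ × ℝ → ℝ} {Gx Gy : ℝ} {X : ℝ³} (hx : cylRadius X ≠ 0)
    (hG : HasFDerivAt G (Gx • ContinuousLinearMap.fst ℝ ℝ ℝ + Gy • ContinuousLinearMap.snd ℝ ℝ ℝ)
      (meridian X)) :
    HasFDerivAt (fun Y => G (meridian Y))
      (Gx • innerSL ℝ (eR X) + Gy • (EuclideanSpace.proj (2 : Fin 3) : ℝ³ →L[ℝ] ℝ)) X := by
  have h := hG.comp X (hasFDerivAt_meridian hx)
  refine h.congr_fderiv ?_
  ext v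
  simp [innerSL_apply_apply]

/-- `D(X₀² + X₁²) = 2X₀ dX₀ + 2X₁ dX₁`. [folklore] -/
theorem hasFDerivAt_sumSq (X : ℝ³) :
    HasFDerivAt (fun Y : ℝ³ => Y 0 ^ 2 + Y 1 ^ 2)
      ((2 * X 0) • (EuclideanSpace.proj (0 : Fin 3) : ℝ³ →L[ℝ] ℝ) +
        (2 * X 1) • (EuclideanSpace.proj (1 : Fin 3) : ℝ³ →L[ℝ] ℝ)) X := by
  have h0 := hasFDerivAt_coord 0 X
  have h1 := hasFDerivAt_coord 1 X
  have e : (fun Y : ℝ³ => Y 0 ^ 2 + Y 1 ^ 2) = fun Y : ℝ³ => Y 0 * Y 0 + Y 1 * Y 1 :=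
    funext fun Y => by ring
  rw [e]
  refine ((h0.mul h0).add (h1.mul h1)).congr_fderiv ?_
  ext v
  simp only [_root_.add_apply, _root_.smul_apply, smul_eq_mul, PiLp.proj_apply]
  ring

/-- `D((X₀² + X₁²)⁻¹)`. [folklore] -/
theorem hasFDerivAt_sumSq_inv {X : ℝ³} (hX : X 0 ^ 2 + X 1 ^ 2 ≠ 0) :
    HasFDerivAt (fun Y : ℝ³ => (Y 0 ^ 2 + Y 1 ^ 2)⁻¹)
      ((-((X 0 ^ 2 + X 1 ^ 2) ^ 2)⁻¹) • ((2 * X 0) • (EuclideanSpace.proj (0 : Fin 3) : ℝ³ →L[ℝ] ℝ) +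
        (2 * X 1) • (EuclideanSpace.proj (1 : Fin 3) : ℝ³ →L[ℝ] ℝ))) X :=
  (hasDerivAt_inv hX).comp_hasFDerivAt X (hasFDerivAt_sumSq X)

/-- `D(ρ⁻¹) = −ρ⁻² ⟪e_r, ·⟫`. [folklore] -/
theorem hasFDerivAt_cylRadius_inv {X : ℝ³} (hx : cylRadius X ≠ 0) :
    HasFDerivAt (fun Y : ℝ³ => (cylRadius Y)⁻¹) ((-(cylRadius X ^ 2)⁻¹) • innerSL ℝ (eR X)) X :=
  (hasDerivAt_inv hx).comp_hasFDerivAt X (hasFDerivAt_cylRadius hx)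

/-- Components of the gradient: `(∇f)ᵢ = Df(eᵢ)`. [folklore] -/
theorem gradient_apply (f : ℝ³ → ℝ) (X : ℝ³) (i : Fin 3) :
    gradient f X i = fderiv ℝ f X (EuclideanSpace.single i 1) := by
  have h : gradient f X i = ⟪EuclideanSpace.single i (1 : ℝ), gradient f X⟫ := by
    rw [EuclideanSpace.inner_single_left]
    simp
  rw [h, real_inner_comm, gradient, toDual_symm_apply]

/-- Components of the Fréchet derivative of a vector field. [folklore] -/
theorem fderiv_apply_comp {V : ℝ³ → ℝ³} {X : ℝ³} (hV : DifferentiableAt ℝ V X) (v : ℝ³) (i : Fin 3) :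
    fderiv ℝ V X v i = fderiv ℝ (fun Y => V Y i) X v := by
  have h := ((EuclideanSpace.proj i : ℝ³ →L[ℝ] ℝ).hasFDerivAt.comp X hV.hasFDerivAt).fderiv
  have e : (⇑(EuclideanSpace.proj i : ℝ³ →L[ℝ] ℝ) ∘ V) = fun Y => V Y i := rfl
  rw [e] at h
  rw [h]
  rfl

/-- The divergence in coordinates: `div V = Σᵢ ∂ᵢVᵢ`. [folklore] -/
theorem divergence_eq_sum {V : ℝ³ → ℝ³} {X : ℝ³} (hV : DifferentiableAt ℝ V X) :
    VectorCalculus.divergence V X =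
      ∑ i : Fin 3, fderiv ℝ (fun Y => V Y i) X (EuclideanSpace.single i 1) := by
  rw [divergence_eq_sum_inner_fderiv (EuclideanSpace.basisFun (Fin 3) ℝ)]
  refine Finset.sum_congr rfl fun i _ => ?_
  rw [EuclideanSpace.basisFun_apply, EuclideanSpace.inner_single_left, fderiv_apply_comp hV]
  simp

/-! ### Evaluation of the basic covectors -/

/-- Components of `e_r`. [folklore] -/
@[simp] theorem eR_apply_zero' (X : ℝ³) : eR X 0 = (cylRadius X)⁻¹ * X 0 := by
  simp [eR]

/-- Components of `e_r`. [folklore] -/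
@[simp] theorem eR_apply_one' (X : ℝ³) : eR X 1 = (cylRadius X)⁻¹ * X 1 := by
  simp [eR]

/-- `⟪e_r, v⟫ = (X₀v₀ + X₁v₁)/ρ`. [folklore] -/
theorem inner_eR_left (X v : ℝ³) :
    ⟪eR X, v⟫ = (cylRadius X)⁻¹ * X 0 * v 0 + (cylRadius X)⁻¹ * X 1 * v 1 := by
  simp [PiLp.inner_apply, Fin.sum_univ_three]
  ring

/-- The radial velocity of `U` is `a_z/ρ`: `⟪e_r, U⟫ = a_z(ρ,z)/ρ`. [cite: Gavrilov2019, §3 (4)] -/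
theorem inner_eR_U {X : ℝ³} (hX : X ∈ A.tube) : ⟪eR X, A.U X⟫ = (cylRadius X)⁻¹ * A.lay X := by
  rw [inner_eR_left, U_apply_zero, U_apply_one]
  have hS := sumSq_ne_zero hX
  field_simp
  ring

/-- **The swirl of `U` is `c`**: `X₀U₁ − X₁U₀ = c(ρ, z)`. [cite: Gavrilov2019, §3 (4)] -/
theorem swirl_U {X : ℝ³} (hX : X ∈ A.tube) : swirl A.U X = A.lc X := by
  rw [swirl, U_apply_zero, U_apply_one]
  have hS := sumSq_ne_zero hX
  field_simp
  ring

/-! ### The derivatives of the components of `U` and of `P` -/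

section pointwise

variable {X : ℝ³} (hX : X ∈ A.tube)
include hX

/-- `D(a ∘ meridian)`. [folklore] -/
theorem hasFDerivAt_la : HasFDerivAt A.la (A.ax (meridian X) • innerSL ℝ (eR X) +
    A.ay (meridian X) • (EuclideanSpace.proj (2 : Fin 3) : ℝ³ →L[ℝ] ℝ)) X :=
  hasFDerivAt_lift (cylRadius_ne_zero hX) (A.hasFDerivAt_a _ hX)

/-- `D(a_ρ ∘ meridian)`. [folklore] -/
theorem hasFDerivAt_lax : HasFDerivAt A.lax (A.axx (meridian X) • innerSL ℝ (eR X) +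
    A.axy (meridian X) • (EuclideanSpace.proj (2 : Fin 3) : ℝ³ →L[ℝ] ℝ)) X :=
  hasFDerivAt_lift (cylRadius_ne_zero hX) (A.hasFDerivAt_ax _ hX)

/-- `D(a_z ∘ meridian)`. [folklore] -/
theorem hasFDerivAt_lay : HasFDerivAt A.lay (A.axy (meridian X) • innerSL ℝ (eR X) +
    A.ayy (meridian X) • (EuclideanSpace.proj (2 : Fin 3) : ℝ³ →L[ℝ] ℝ)) X :=
  hasFDerivAt_lift (cylRadius_ne_zero hX) (A.hasFDerivAt_ay _ hX)

/-- `D(c ∘ meridian)`. [folklore] -/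
theorem hasFDerivAt_lc : HasFDerivAt A.lc (A.cx (meridian X) • innerSL ℝ (eR X) +
    A.cy (meridian X) • (EuclideanSpace.proj (2 : Fin 3) : ℝ³ →L[ℝ] ℝ)) X :=
  hasFDerivAt_lift (cylRadius_ne_zero hX) (A.hasFDerivAt_c _ hX)

/-- `DP = 4 Da`. [folklore] -/
theorem hasFDerivAt_P : HasFDerivAt A.P ((4 : ℝ) • (A.ax (meridian X) • innerSL ℝ (eR X) +
    A.ay (meridian X) • (EuclideanSpace.proj (2 : Fin 3) : ℝ³ →L[ℝ] ℝ))) X :=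
  (hasFDerivAt_la hX).const_mul 4

/-- `DU₀`. [folklore] -/
theorem hasFDerivAt_U_zero : HasFDerivAt (fun Y => A.U Y 0)
    ((A.lay X * X 0 - A.lc X * X 1) • ((-((X 0 ^ 2 + X 1 ^ 2) ^ 2)⁻¹) •
        ((2 * X 0) • (EuclideanSpace.proj (0 : Fin 3) : ℝ³ →L[ℝ] ℝ) +
          (2 * X 1) • (EuclideanSpace.proj (1 : Fin 3) : ℝ³ →L[ℝ] ℝ))) +
      (X 0 ^ 2 + X 1 ^ 2)⁻¹ •
        ((A.lay X • (EuclideanSpace.proj (0 : Fin 3) : ℝ³ →L[ℝ] ℝ) +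
            X 0 • (A.axy (meridian X) • innerSL ℝ (eR X) +
              A.ayy (meridian X) • (EuclideanSpace.proj (2 : Fin 3) : ℝ³ →L[ℝ] ℝ))) -
          (A.lc X • (EuclideanSpace.proj (1 : Fin 3) : ℝ³ →L[ℝ] ℝ) +
            X 1 • (A.cx (meridian X) • innerSL ℝ (eR X) +
              A.cy (meridian X) • (EuclideanSpace.proj (2 : Fin 3) : ℝ³ →L[ℝ] ℝ))))) X := by
  have h := (((hasFDerivAt_lay hX).mul (hasFDerivAt_coord 0 X)).sub
    ((hasFDerivAt_lc hX).mul (hasFDerivAt_coord 1 X))).mul (hasFDerivAt_sumSq_inv (sumSq_ne_zero hX))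
  exact h.congr_of_eventuallyEq (Eventually.of_forall fun Y => by
    simp only [U_apply_zero, Pi.mul_apply, Pi.sub_apply])

/-- `DU₁`. [folklore] -/
theorem hasFDerivAt_U_one : HasFDerivAt (fun Y => A.U Y 1)
    ((A.lay X * X 1 + A.lc X * X 0) • ((-((X 0 ^ 2 + X 1 ^ 2) ^ 2)⁻¹) •
        ((2 * X 0) • (EuclideanSpace.proj (0 : Fin 3) : ℝ³ →L[ℝ] ℝ) +
          (2 * X 1) • (EuclideanSpace.proj (1 : Fin 3) : ℝ³ →L[ℝ] ℝ))) +
      (X 0 ^ 2 + X 1 ^ 2)⁻¹ •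
        ((A.lay X • (EuclideanSpace.proj (1 : Fin 3) : ℝ³ →L[ℝ] ℝ) +
            X 1 • (A.axy (meridian X) • innerSL ℝ (eR X) +
              A.ayy (meridian X) • (EuclideanSpace.proj (2 : Fin 3) : ℝ³ →L[ℝ] ℝ))) +
          (A.lc X • (EuclideanSpace.proj (0 : Fin 3) : ℝ³ →L[ℝ] ℝ) +
            X 0 • (A.cx (meridian X) • innerSL ℝ (eR X) +
              A.cy (meridian X) • (EuclideanSpace.proj (2 : Fin 3) : ℝ³ →L[ℝ] ℝ))))) X := by
  have h := (((hasFDerivAt_lay hX).mul (hasFDerivAt_coord 1 X)).add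
    ((hasFDerivAt_lc hX).mul (hasFDerivAt_coord 0 X))).mul (hasFDerivAt_sumSq_inv (sumSq_ne_zero hX))
  exact h.congr_of_eventuallyEq (Eventually.of_forall fun Y => by
    simp only [U_apply_one, Pi.mul_apply, Pi.add_apply])

/-- `DU₂`. [folklore] -/
theorem hasFDerivAt_U_two : HasFDerivAt (fun Y => A.U Y 2)
    (-(A.lax X • ((-(cylRadius X ^ 2)⁻¹) • innerSL ℝ (eR X)) +
      (cylRadius X)⁻¹ • (A.axx (meridian X) • innerSL ℝ (eR X) +
        A.axy (meridian X) • (EuclideanSpace.proj (2 : Fin 3) : ℝ³ →L[ℝ] ℝ)))) X := by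
  have h := ((hasFDerivAt_lax hX).mul (hasFDerivAt_cylRadius_inv (cylRadius_ne_zero hX))).neg
  exact h.congr_of_eventuallyEq (Eventually.of_forall fun Y => by
    simp only [U_apply_two, Pi.neg_apply, Pi.mul_apply])

/-- `U` is differentiable on the tube. [folklore] -/
theorem differentiableAt_U : DifferentiableAt ℝ A.U X := by
  rw [differentiableAt_euclidean]
  intro i
  fin_cases i
  · exact (hasFDerivAt_U_zero hX).differentiableAt
  · exact (hasFDerivAt_U_one hX).differentiableAt
  · exact (hasFDerivAt_U_two hX).differentiableAt

/-- **`P` is a first integral**: `U·∇P = 0` (Gavrilov §3: "this flow satisfies an additional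
condition `u·∇p = 0`"). [cite: Gavrilov2019, §3 (after the Lemma)] -/
theorem fderiv_P_U : fderiv ℝ A.P X (A.U X) = 0 := by
  rw [(hasFDerivAt_P hX).fderiv]
  simp only [_root_.smul_apply, _root_.add_apply, smul_eq_mul, innerSL_apply_apply, inner_eR_U hX,
    PiLp.proj_apply, U_apply_two, lay, lax]
  ring

/-- **`div U = 0`** (Gavrilov §3: "Obviously, `div u = 0` outside `𝒞`"). [cite: Gavrilov2019, §3 (after (4))] -/
theorem divergence_U : VectorCalculus.divergence A.U X = 0 := by
  rw [divergence_eq_sum (differentiableAt_U hX), Fin.sum_univ_three,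
    (hasFDerivAt_U_zero hX).fderiv, (hasFDerivAt_U_one hX).fderiv, (hasFDerivAt_U_two hX).fderiv]
  have hr := cylRadius_ne_zero hX
  have hS := sumSq_ne_zero hX
  have hr2 := cylRadius_sq X
  simp only [_root_.smul_apply, _root_.add_apply, _root_.sub_apply, _root_.neg_apply, smul_eq_mul,
    innerSL_apply_apply, inner_eR_left, PiLp.proj_apply, PiLp.single_apply]
  simp
  field_simp
  ring

/-- Components of the convective derivative. [folklore] -/
theorem convect_U_apply (i : Fin 3) :
    convect A.U A.U X i = fderiv ℝ (fun Y => A.U Y i) X (A.U X) := by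
  rw [convect_apply, fderiv_apply_comp (differentiableAt_U hX)]

/-- **The `e_z`-component of the Euler equation** reduces to Gavrilov's third identity.
[cite: Gavrilov2019, §3 (proof of the Lemma)] -/
theorem euler_two : convect A.U A.U X 2 + gradient A.P X 2 = 0 := by
  rw [convect_U_apply hX, gradient_apply, (hasFDerivAt_U_two hX).fderiv, (hasFDerivAt_P hX).fderiv]
  have hr := cylRadius_ne_zero hX
  have hS := sumSq_ne_zero hX
  have hr2 := cylRadius_sq X
  have h3 := A.pde3 _ hX
  simp only [meridian_apply] at h3
  simp only [_root_.smul_apply, _root_.add_apply, _root_.neg_apply, smul_eq_mul,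
    innerSL_apply_apply, inner_eR_U hX, inner_eR_left, PiLp.proj_apply, PiLp.single_apply,
    U_apply_two, lay, lax, meridian_apply]
  simp
  field_simp
  linear_combination h3

/-- **The `e_ρ`/`e_φ`-components of the Euler equation, first Cartesian component**, reduce to
Gavrilov's first identity and `{c, a} = 0`. [cite: Gavrilov2019, §3 (proof of the Lemma)] -/
theorem euler_zero : convect A.U A.U X 0 + gradient A.P X 0 = 0 := by
  rw [convect_U_apply hX, gradient_apply, (hasFDerivAt_U_zero hX).fderiv, (hasFDerivAt_P hX).fderiv]
  have hr := cylRadius_ne_zero hX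
  have hS := sumSq_ne_zero hX
  have hr2 := cylRadius_sq X
  have h1 := A.pde1 _ hX
  have hb := A.bracket _ hX
  simp only [meridian_apply] at h1 hb
  simp only [_root_.smul_apply, _root_.add_apply, _root_.sub_apply, smul_eq_mul,
    innerSL_apply_apply, inner_eR_U hX, inner_eR_left, PiLp.proj_apply, PiLp.single_apply,
    U_apply_zero, U_apply_one, U_apply_two, lay, lax, lc, meridian_apply]
  simp
  field_simp
  linear_combination (-(X 0 * cylRadius X * (X 0 ^ 2 + X 1 ^ 2))) * h1 -
    (X 1 * (X 0 ^ 2 + X 1 ^ 2) ^ 2) * hb +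
    (X 0 * (X 0 ^ 2 + X 1 ^ 2) * (A.ax (cylRadius X, X 2) * A.ayy (cylRadius X, X 2) -
      A.ay (cylRadius X, X 2) * A.axy (cylRadius X, X 2)) -
      4 * X 0 * (X 0 ^ 2 + X 1 ^ 2) * A.ax (cylRadius X, X 2) * (cylRadius X ^ 2 + (X 0 ^ 2 + X 1 ^ 2))) * hr2

/-- **The `e_ρ`/`e_φ`-components of the Euler equation, second Cartesian component**.
[cite: Gavrilov2019, §3 (proof of the Lemma)] -/
theorem euler_one : convect A.U A.U X 1 + gradient A.P X 1 = 0 := by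
  rw [convect_U_apply hX, gradient_apply, (hasFDerivAt_U_one hX).fderiv, (hasFDerivAt_P hX).fderiv]
  have hr := cylRadius_ne_zero hX
  have hS := sumSq_ne_zero hX
  have hr2 := cylRadius_sq X
  have h1 := A.pde1 _ hX
  have hb := A.bracket _ hX
  simp only [meridian_apply] at h1 hb
  simp only [_root_.smul_apply, _root_.add_apply, smul_eq_mul,
    innerSL_apply_apply, inner_eR_U hX, inner_eR_left, PiLp.proj_apply, PiLp.single_apply,
    U_apply_zero, U_apply_one, U_apply_two, lay, lax, lc, meridian_apply]
  simp
  field_simp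
  linear_combination (-(X 1 * cylRadius X * (X 0 ^ 2 + X 1 ^ 2))) * h1 +
    (X 0 * (X 0 ^ 2 + X 1 ^ 2) ^ 2) * hb +
    (X 1 * (X 0 ^ 2 + X 1 ^ 2) * (A.ax (cylRadius X, X 2) * A.ayy (cylRadius X, X 2) -
      A.ay (cylRadius X, X 2) * A.axy (cylRadius X, X 2)) -
      4 * X 1 * (X 0 ^ 2 + X 1 ^ 2) * A.ax (cylRadius X, X 2) * (cylRadius X ^ 2 + (X 0 ^ 2 + X 1 ^ 2))) * hr2

/-- **Gavrilov's Lemma of §3**: the ansatz solves the steady Euler equations,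
`(U·∇)U + ∇P = 0`, on the tube. [cite: Gavrilov2019, §3 (the Lemma after (4))] -/
theorem convect_U_add_gradient_P : convect A.U A.U X + gradient A.P X = 0 := by
  ext i
  fin_cases i
  · simpa using euler_zero hX
  · simpa using euler_one hX
  · simpa using euler_two hX

end pointwise

/-! ### Smoothness and symmetry -/

/-- The meridian projection is smooth off the axis (the radius is `√(X₀² + X₁²)` with
`X₀² + X₁² ≠ 0`; cf. `contDiffAt_cylRadius` in `SwirlCutoff.lean`, not imported here). [folklore] -/
theorem contDiffAt_meridian {X : ℝ³} (hx : cylRadius X ≠ 0) {n : WithTop ℕ∞} :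
    ContDiffAt ℝ n meridian X := by
  have hne : X 0 ^ 2 + X 1 ^ 2 ≠ 0 := by rw [← cylRadius_sq]; exact pow_ne_zero 2 hx
  have h : ContDiffAt ℝ n (fun Y : ℝ³ => Y 0 ^ 2 + Y 1 ^ 2) X := by fun_prop
  have hr : ContDiffAt ℝ n cylRadius X := h.sqrt hne
  exact hr.prodMk (by fun_prop)

/-- The meridian projection is smooth on the tube. [folklore] -/
theorem contDiffOn_meridian_tube {n : WithTop ℕ∞} : ContDiffOn ℝ n meridian A.tube := fun _ hX =>
  (contDiffAt_meridian (cylRadius_ne_zero hX)).contDiffWithinAt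

/-- Lifts of functions smooth on the meridian domain are smooth on the tube. [folklore] -/
theorem contDiffOn_lift {G : ℝ × ℝ → ℝ} (hG : ContDiffOn ℝ (⊤ : ℕ∞) G A.W) :
    ContDiffOn ℝ (⊤ : ℕ∞) (fun Y => G (meridian Y)) A.tube :=
  hG.comp contDiffOn_meridian_tube fun _ hX => hX

/-- **`P` is smooth on the tube.** [folklore] -/
theorem contDiffOn_P : ContDiffOn ℝ (⊤ : ℕ∞) A.P A.tube :=
  contDiffOn_const.mul (contDiffOn_lift A.contDiffOn_a)

/-- **`U` is smooth on the tube.** [folklore] -/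
theorem contDiffOn_U : ContDiffOn ℝ (⊤ : ℕ∞) A.U A.tube := by
  have hay : ContDiffOn ℝ (⊤ : ℕ∞) A.lay A.tube := contDiffOn_lift A.contDiffOn_ay
  have hax : ContDiffOn ℝ (⊤ : ℕ∞) A.lax A.tube := contDiffOn_lift A.contDiffOn_ax
  have hc : ContDiffOn ℝ (⊤ : ℕ∞) A.lc A.tube := contDiffOn_lift A.contDiffOn_c
  have h0' : ContDiffOn ℝ (⊤ : ℕ∞) (fun Y : ℝ³ => Y 0) A.tube := by fun_prop
  have h1' : ContDiffOn ℝ (⊤ : ℕ∞) (fun Y : ℝ³ => Y 1) A.tube := by fun_prop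
  have hS : ContDiffOn ℝ (⊤ : ℕ∞) (fun Y : ℝ³ => (Y 0 ^ 2 + Y 1 ^ 2)⁻¹) A.tube :=
    ContDiffOn.inv (by fun_prop) fun Y hY => sumSq_ne_zero hY
  have hr : ContDiffOn ℝ (⊤ : ℕ∞) (fun Y : ℝ³ => (cylRadius Y)⁻¹) A.tube :=
    ContDiffOn.inv (contDiffOn_meridian_tube.fst.congr fun Y _ => rfl) fun Y hY => cylRadius_ne_zero hY
  rw [contDiffOn_euclidean]
  intro i
  fin_cases i
  · exact ((hay.mul h0').sub (hc.mul h1')).mul hS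
  · exact ((hay.mul h1').add (hc.mul h0')).mul hS
  · exact (hax.mul hr).neg

/-- **`U` is rotation-equivariant** (axisymmetric): `U(R_θ X) = R_θ U(X)`. [cite: Gavrilov2019, §3 (axial symmetry of (4))] -/
theorem U_rotZ (θ : ℝ) (X : ℝ³) : A.U (rotZ θ X) = rotZ θ (A.U X) := by
  -- `meridian (rotZ θ X) = meridian X` (cf. `SereginZajaczkowski2007.meridian_rotZ`, not imported)
  have hm : meridian (rotZ θ X) = meridian X := by
    rw [meridian_apply, meridian_apply, cylRadius_rotZ, rotZ_apply_two]
  have hlay : A.lay (rotZ θ X) = A.lay X := by simp only [lay, hm]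
  have hlax : A.lax (rotZ θ X) = A.lax X := by simp only [lax, hm]
  have hlc : A.lc (rotZ θ X) = A.lc X := by simp only [lc, hm]
  have hsq : (Real.cos θ * X 0 - Real.sin θ * X 1) ^ 2 + (Real.sin θ * X 0 + Real.cos θ * X 1) ^ 2 =
      X 0 ^ 2 + X 1 ^ 2 := by
    linear_combination (X 0 ^ 2 + X 1 ^ 2) * Real.sin_sq_add_cos_sq θ
  ext i
  fin_cases i
  · show A.U (rotZ θ X) 0 = rotZ θ (A.U X) 0
    rw [U_apply_zero, rotZ_apply_zero, rotZ_apply_zero, rotZ_apply_one, hlay, hlc, hsq, U_apply_zero,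
      U_apply_one]
    ring
  · show A.U (rotZ θ X) 1 = rotZ θ (A.U X) 1
    rw [U_apply_one, rotZ_apply_one, rotZ_apply_zero, rotZ_apply_one, hlay, hlc, hsq, U_apply_zero,
      U_apply_one]
    ring
  · show A.U (rotZ θ X) 2 = rotZ θ (A.U X) 2
    rw [U_apply_two, rotZ_apply_two, hlax, cylRadius_rotZ, U_apply_two]

/-- **`P` is rotation-invariant** (axisymmetric). [cite: Gavrilov2019, §3 (axial symmetry of (4))] -/
theorem P_rotZ (θ : ℝ) (X : ℝ³) : A.P (rotZ θ X) = A.P X := by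
  have hm : meridian (rotZ θ X) = meridian X := by
    rw [meridian_apply, meridian_apply, cylRadius_rotZ, rotZ_apply_two]
  simp only [P, la, hm]

end AnsatzData

end Gavrilov

end Literature.Analysis.FluidPDE
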